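import Mathlib
import Summits.Ventures.LatticeQCDFlow.TrivializingMaps.GradedData

/-!
# The Casimir-graded Lüscher series, II: the recursion (THEORY-1 §19.3–19.4, file (5d-ii))

HONEST FRAMING. Exact (Metropolis-corrected) sampling algorithms for lattice gauge theory; figures of
merit are autocorrelation/cost numbers at stated couplings and volumes; no continuum-physics claim.
This file proves that the explicit graded data of `GradedData` solve Lüscher's recursion; it makes no
convergence claim (that is THEOREM T / file (6)).

Main results: `Gen.vertex_sum` (`-∑ₑ∑ₐ ∂S·∂G.func = ∑_children childF` on `SU(n)^E`),
`Gen.linkLap_step_func_coeConfig` (the step of the recursion), `linkLap_gen0_func_coeConfig` (the base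
case), and for `gradedSk B k := (pack B k).G.func`:
`isLuscherSeries_gradedSk : IsLuscherSeries B ambWilsonAction (gradedSk B) (gradedConst B)`,
`contDiff_gradedSk`, and `linkDeriv_eq_gradedSk`: by `SeriesUniqueness`, EVERY smooth Lüscher series of
the Wilson action (e.g. the tree's `wilsonSk`) has the graded series' link gradients on `SU(n)^E` and its
constants — so bounds on the graded data bound `LuscherGeometricGradientBound`'s left-hand side.
[ours (bookkeeping); cite: Luscher2010Trivializing §4.3 eqs. (4.9)–(4.15)]
-/

noncomputable section

namespace Summit.Ventures.LatticeQCDFlow.TrivializingMaps.GradedSeries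

open scoped ComplexConjugate Matrix Matrix.Norms.Frobenius InnerProductSpace ContDiff
open Finset
open Literature.MathematicalPhysics.QuantumFieldTheory
open Literature.MathematicalPhysics.QuantumFieldTheory.Luscher2010
open SlotRepresentation SlotCasimir SlotCoefficient SlotHilbert JointGrading CasimirGrading PlaquetteData
  SlotTensor TensorShift RankOne Vertex

variable {d L n : ℕ} [NeZero L]

namespace Gen
variable {B : SuBasis n} {σ : Type} [Fintype σ] [DecidableEq σ] (G : Gen (d := d) (L := L) B σ)


/-! ## 4. The recursion -/

omit [NeZero L] in
/-- `termF` with coefficient `0` vanishes. [ours] -/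
theorem termF_zero_left {τ : Type} [Fintype τ] [DecidableEq τ] (lnk : τ → Edge d L) (pol : τ → Bool)
    (x y : SlotSpace τ n) (W : AmbConfig d L n) : termF lnk pol 0 x y W = 0 := by
  rw [termF_apply, zero_mul, Complex.zero_re]

/-- A mode with `c(m) = 0` has all `m_e = 0`. [ours] -/
theorem mode_re_eq_zero_of_modeC {τ : Type} [Fintype τ] [DecidableEq τ] (lnk : τ → Edge d L)
    (pol : τ → Bool) (m : Modes (casimirFamily lnk pol B)) (h : modeC lnk pol B m = 0) (e : Edge d L) :
    (m e : ℂ).re = 0 :=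
  (Finset.sum_eq_zero_iff_of_nonneg fun e _ => slotMode_nonneg lnk pol B m e).1 h e (Finset.mem_univ e)

/-- `Δ` of the next generation: `Δ (step G).func = ∑_{j : c(m'_j) ≠ 0} childF j` everywhere. [ours] -/
theorem linkLap_step_func (W : AmbConfig d L n) :
    linkLap B G.step.func W = ∑ j : G.CIdx, if G.step.cm j = 0 then 0 else G.childF j W := by
  rw [Gen.linkLap_func]
  refine Finset.sum_congr rfl fun j _ => ?_
  rw [Gen.term, ← termF_real_mul_left,
    show ((G.step.cm j : ℝ) : ℂ) * G.step.z j = if G.step.cm j = 0 then 0 else G.zhalf j.2.2.1 j.2.2.2.1 from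
      ofReal_mul_zdiv _ _]
  split_ifs with h
  · exact termF_zero_left _ _ _ _ W
  · rfl

/-- Zero-mode children are constant on the field manifold. [ours] -/
theorem childF_coeConfig_eq_of_cm_eq_zero (j : G.CIdx) (h : G.step.cm j = 0)
    (U : GaugeConfig d L (Matrix.specialUnitaryGroup (Fin n) ℂ)) :
    G.childF j (WilsonFlow.coeConfig U) = G.childF j (WilsonFlow.coeConfig fun _ => 1) :=
  termF_coeConfig_eq_of_mode_zero _ _ B _ _ _ _ (mode_re_eq_zero_of_modeC _ _ _ h) U

/-- Sums over the child index, iterated. [ours] -/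
theorem sum_CIdx (F : G.CIdx → ℝ) :
    ∑ j, F j = ∑ e : Edge d L, ∑ a : B.ι, ∑ i : G.I, ∑ p : Site d L × Fin d × Fin d, ∑ b : Bool,
      ∑ c : Fin n × Fin n × Fin n × Fin n, ∑ mo : G.CModes i p b, F ⟨e, a, i, p, b, c, mo⟩ := by
  rw [Fintype.sum_sigma]; refine Finset.sum_congr rfl fun e _ => ?_
  rw [Fintype.sum_sigma]; refine Finset.sum_congr rfl fun a _ => ?_
  rw [Fintype.sum_sigma]; refine Finset.sum_congr rfl fun i _ => ?_
  rw [Fintype.sum_sigma]; refine Finset.sum_congr rfl fun p _ => ?_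
  rw [Fintype.sum_sigma]; refine Finset.sum_congr rfl fun b _ => ?_
  exact Fintype.sum_prod_type _

/-- **The vertex, summed**: on the field manifold,
`-∑ₑ∑ₐ ∂^a_e S · ∂^a_e G.func = ∑_j childF j`. [ours] -/
theorem vertex_sum (U : GaugeConfig d L (Matrix.specialUnitaryGroup (Fin n) ℂ)) :
    -(∑ e : Edge d L, ∑ a : B.ι, linkDeriv e (B.T a) (ambWilsonAction : AmbConfig d L n → ℝ)
        (WilsonFlow.coeConfig U) * linkDeriv e (B.T a) G.func (WilsonFlow.coeConfig U))
      = ∑ j : G.CIdx, G.childF j (WilsonFlow.coeConfig U) := by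
  rw [sum_CIdx]
  simp only [Gen.linkDeriv_func, Finset.mul_sum, ← Finset.sum_neg_distrib]
  refine Finset.sum_congr rfl fun e _ => Finset.sum_congr rfl fun a _ => Finset.sum_congr rfl fun i _ => ?_
  rw [Gen.term, vertex B (G.lnk i) (G.pol i) (G.z i) (G.x i) (G.y i) e a]
  refine Finset.sum_congr rfl fun p _ => ?_
  split_ifs with hp
  · refine Finset.sum_congr rfl fun b _ => Finset.sum_congr rfl fun c _ => ?_
    simp only [Gen.childF, Gen.step, Gen.y, Gen.zhalf, if_pos hp, Gen.clnk, Gen.cpol, Gen.cx, Gen.cv]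
    exact termF_coeConfig_eq_sum _ _ B _ _ _ U
  · symm
    refine Finset.sum_eq_zero fun b _ => Finset.sum_eq_zero fun c _ => Finset.sum_eq_zero fun mo _ => ?_
    simp only [Gen.childF, Gen.zhalf, if_neg hp]
    exact termF_zero_left _ _ _ _ _

/-- **The recursion step on the field manifold**:
`Δ (step G).func = -∑ₑ∑ₐ ∂^a_e S · ∂^a_e G.func + stepConst`. [ours] -/
theorem linkLap_step_func_coeConfig (U : GaugeConfig d L (Matrix.specialUnitaryGroup (Fin n) ℂ)) :
    linkLap B G.step.func (WilsonFlow.coeConfig U)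
      = -(∑ e : Edge d L, ∑ a : B.ι, linkDeriv e (B.T a) (ambWilsonAction : AmbConfig d L n → ℝ)
          (WilsonFlow.coeConfig U) * linkDeriv e (B.T a) G.func (WilsonFlow.coeConfig U)) + G.stepConst := by
  rw [vertex_sum, linkLap_step_func, Gen.stepConst, ← sub_eq_add_neg, ← Finset.sum_sub_distrib]
  refine Finset.sum_congr rfl fun j _ => ?_
  split_ifs with h
  · rw [G.childF_coeConfig_eq_of_cm_eq_zero j h U]; ring
  · ring

end Gen

/-! ## 5. The base case -/

section Base
variable (B : SuBasis n)

omit [NeZero L] in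
/-- `termF` with coefficient `-1`. [ours] -/
theorem termF_neg_one_left {τ : Type} [Fintype τ] [DecidableEq τ] (lnk : τ → Edge d L) (pol : τ → Bool)
    (x y : SlotSpace τ n) (W : AmbConfig d L n) : termF lnk pol (-1) x y W = -termF lnk pol 1 x y W := by
  rw [show (-1 : ℂ) = ((-1 : ℝ) : ℂ) * 1 by simp, termF_real_mul_left, neg_one_mul]

/-- `Δ` of generation 0, everywhere: `-∑_{p<, c(m) ≠ 0} baseF`. [ours] -/
theorem linkLap_gen0_func (W : AmbConfig d L n) :
    linkLap B (gen0 (d := d) (L := L) B).func W = ∑ j : Idx0 (d := d) (L := L) B,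
      if j.1.1.2.1 < j.1.1.2.2 then (if (gen0 (d := d) (L := L) B).cm j = 0 then 0 else -baseF B j W)
      else 0 := by
  rw [Gen.linkLap_func]
  refine Finset.sum_congr rfl fun j _ => ?_
  have hz : (((gen0 (d := d) (L := L) B).cm j : ℝ) : ℂ) * (gen0 (d := d) (L := L) B).z j
      = if j.1.1.2.1 < j.1.1.2.2 then (if (gen0 (d := d) (L := L) B).cm j = 0 then 0 else -1) else 0 := by
    show ((modeC (plaqIdx j.1.1.1 j.1.1.2.1 j.1.1.2.2) plaqPol B j.2 : ℝ) : ℂ)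
        * (if j.1.1.2.1 < j.1.1.2.2 then zneg (modeC (plaqIdx j.1.1.1 j.1.1.2.1 j.1.1.2.2) plaqPol B j.2)
          else 0)
      = if j.1.1.2.1 < j.1.1.2.2 then
          (if modeC (plaqIdx j.1.1.1 j.1.1.2.1 j.1.1.2.2) plaqPol B j.2 = 0 then 0 else -1) else 0
    by_cases h1 : j.1.1.2.1 < j.1.1.2.2
    · rw [if_pos h1, if_pos h1]; exact ofReal_mul_zneg _
    · rw [if_neg h1, if_neg h1, mul_zero]
  rw [Gen.term, ← termF_real_mul_left, hz]
  split_ifs with h1 h2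
  · exact Gen.termF_zero_left _ _ _ _ W
  · exact termF_neg_one_left _ _ _ _ W
  · exact Gen.termF_zero_left _ _ _ _ W

/-- The Wilson action on the field manifold, re-graded: `S = N - ∑_{p<} baseF`. [ours] -/
theorem ambWilsonAction_coeConfig_eq (U : GaugeConfig d L (Matrix.specialUnitaryGroup (Fin n) ℂ)) :
    ambWilsonAction (WilsonFlow.coeConfig U)
      = (∑ p : Site d L × Fin d × Fin d, if p.2.1 < p.2.2 then (n : ℝ) else 0)
        - ∑ j : Idx0 (d := d) (L := L) B,
            if j.1.1.2.1 < j.1.1.2.2 then baseF B j (WilsonFlow.coeConfig U) else 0 := by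
  rw [ambWilsonAction_eq_termF, sum_Idx0, ← Finset.sum_sub_distrib]
  refine Finset.sum_congr rfl fun p _ => ?_
  split_ifs with hp
  · rw [sub_right_inj]
    refine Finset.sum_congr rfl fun c _ => ?_
    simp only [baseF, gen0, Gen.y]
    exact termF_coeConfig_eq_sum _ _ B _ _ _ U
  · simp

/-- Zero-mode plaquette terms are constant on the field manifold. [ours] -/
theorem baseF_coeConfig_eq_of_cm_eq_zero (j : Idx0 (d := d) (L := L) B) (h : (gen0 (d := d) (L := L) B).cm j = 0)
    (U : GaugeConfig d L (Matrix.specialUnitaryGroup (Fin n) ℂ)) :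
    baseF B j (WilsonFlow.coeConfig U) = baseF B j (WilsonFlow.coeConfig fun _ => 1) :=
  termF_coeConfig_eq_of_mode_zero ((gen0 (d := d) (L := L) B).lnk j) ((gen0 (d := d) (L := L) B).pol j) B 1
    ((gen0 (d := d) (L := L) B).x j) ((gen0 (d := d) (L := L) B).m j) ((gen0 (d := d) (L := L) B).v j)
    (Gen.mode_re_eq_zero_of_modeC _ _ _ h) U

/-- **The base case on the field manifold**: `Δ (gen0).func = S + const0`. [ours] -/
theorem linkLap_gen0_func_coeConfig (U : GaugeConfig d L (Matrix.specialUnitaryGroup (Fin n) ℂ)) :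
    linkLap B (gen0 (d := d) (L := L) B).func (WilsonFlow.coeConfig U)
      = ambWilsonAction (WilsonFlow.coeConfig U) + const0 (d := d) (L := L) B := by
  rw [linkLap_gen0_func, ambWilsonAction_coeConfig_eq, const0]
  have h : ∀ j : Idx0 (d := d) (L := L) B,
      (if j.1.1.2.1 < j.1.1.2.2 then
          (if (gen0 (d := d) (L := L) B).cm j = 0 then 0 else -baseF B j (WilsonFlow.coeConfig U)) else 0)
        = -(if j.1.1.2.1 < j.1.1.2.2 then baseF B j (WilsonFlow.coeConfig U) else 0)
          + (if j.1.1.2.1 < j.1.1.2.2 then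
              (if (gen0 (d := d) (L := L) B).cm j = 0 then baseF B j (WilsonFlow.coeConfig fun _ => 1) else 0)
            else 0) := by
    intro j
    by_cases h1 : j.1.1.2.1 < j.1.1.2.2
    · by_cases h2 : (gen0 (d := d) (L := L) B).cm j = 0
      · rw [if_pos h1, if_pos h1, if_pos h1, if_pos h2, if_pos h2, baseF_coeConfig_eq_of_cm_eq_zero B j h2 U,
          neg_add_cancel]
      · rw [if_pos h1, if_pos h1, if_pos h1, if_neg h2, if_neg h2, add_zero]
    · rw [if_neg h1, if_neg h1, if_neg h1, neg_zero, add_zero]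
  rw [Finset.sum_congr rfl fun j _ => h j, Finset.sum_add_distrib, Finset.sum_neg_distrib]
  linarith

end Base

/-! ## 6. The graded series -/

/-- A generation together with its slot type. [ours] -/
structure Pack (B : SuBasis n) : Type 1 where
  /-- slot type -/
  σ : Type
  /-- finite -/
  [instF : Fintype σ]
  /-- decidable -/
  [instD : DecidableEq σ]
  /-- the generation -/
  G : Gen (d := d) (L := L) B σ

/-- The slot type of a pack is finite (bundled instance, registered by an `instance` declaration). [ours] -/
instance Pack.instFintypeσ {B : SuBasis n} (P : Pack (d := d) (L := L) B) : Fintype P.σ := P.instF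

/-- The slot type of a pack has decidable equality (bundled instance). [ours] -/
instance Pack.instDecidableEqσ {B : SuBasis n} (P : Pack (d := d) (L := L) B) : DecidableEq P.σ := P.instD

/-- The generations: `pack 0 = gen0`, `pack (k+1) = step (pack k)`. [ours] -/
def pack (B : SuBasis n) : ℕ → Pack (d := d) (L := L) B
  | 0 => { σ := Fin 4, G := gen0 B }
  | k + 1 => { σ := Fin 4 ⊕ (pack B k).σ, G := (pack B k).G.step }

/-- **The Casimir-graded Lüscher series** `S̃^{(k)} = (pack k).func`. [ours] -/
def gradedSk (B : SuBasis n) (k : ℕ) : AmbConfig d L n → ℝ := (pack (d := d) (L := L) B k).G.func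

/-- Its constants `Ċ^{(k)}`. [ours] -/
def gradedConst (B : SuBasis n) : ℕ → ℝ
  | 0 => const0 (d := d) (L := L) B
  | k + 1 => (pack (d := d) (L := L) B k).G.stepConst

/-- Every `S̃^{(k)}` is smooth on the ambient space. [ours] -/
theorem contDiff_gradedSk (B : SuBasis n) (k : ℕ) : ContDiff ℝ ∞ (gradedSk (d := d) (L := L) B k) :=
  (pack B k).G.contDiff_func

/-- **The graded series solves Lüscher's recursion** for the Wilson action. [ours] -/
theorem isLuscherSeries_gradedSk (B : SuBasis n) :
    IsLuscherSeries B (ambWilsonAction : AmbConfig d L n → ℝ) (gradedSk (d := d) (L := L) B)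
      (gradedConst (d := d) (L := L) B) :=
  ⟨fun U => linkLap_gen0_func_coeConfig B U, fun k U => (pack B k).G.linkLap_step_func_coeConfig U⟩

/-- **The graded series has the link gradients and constants of every smooth Lüscher series**, in
particular of the tree's `wilsonSk` (`SeriesUniqueness`). [ours] -/
theorem linkDeriv_eq_gradedSk (B : SuBasis n) {Sk : ℕ → AmbConfig d L n → ℝ} {c : ℕ → ℝ}
    (hsm : ∀ k, ContDiff ℝ ∞ (Sk k)) (h : IsLuscherSeries B (ambWilsonAction : AmbConfig d L n → ℝ) Sk c)
    (k : ℕ) :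
    c k = gradedConst (d := d) (L := L) B k ∧
      ∀ (e : Edge d L) (a : B.ι) (U : GaugeConfig d L (Matrix.specialUnitaryGroup (Fin n) ℂ)),
        linkDeriv e (B.T a) (Sk k) (WilsonFlow.coeConfig U)
          = linkDeriv e (B.T a) (gradedSk (d := d) (L := L) B k) (WilsonFlow.coeConfig U) :=
  IsLuscherSeries.linkDeriv_eq h (isLuscherSeries_gradedSk B) hsm (contDiff_gradedSk B) k

end Summit.Ventures.LatticeQCDFlow.TrivializingMaps.GradedSeries
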